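import Summits.BirchSwinnertonDyer.BirchSwinnertonDyer.Theorems.PrintCf2SplitBadTwoQuadraticPartHecke
import Literature.NumberTheory.GaloisRepresentations.HeckeCharacterGaloisAvatarProofs
import Literature.NumberTheory.GaloisRepresentations.GaloisRepFrobeniusProofs
import Literature.NumberTheory.GaloisRepresentations.CMTypeHeckeCharacter
import Literature.NumberTheory.EllipticCurves.BDPAnticyclotomicPAdicLFunction
import HarnessLib

/-!
# The Hecke character of the sign is QUADRATIC and the sign is its `2`-adic avatar
# (width brick B11c, road α: the `θK * θK = 1` binder of the v10 frame and `IsPAdicAvatarOf ι θK r_θ`)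

Cell `bsd-print-cf2`, seat `bsd-line-cf2-p1-w4` g7, crux `stmt-BirchSwinnertonDyer-20368`
`PrintCf2.SplitBadTwoRankOneOfFacts`.  Theses-free; `--supports` the crux.  Continues
`…QuadraticPart` (B11: the sign `θ̂` of a continuous `χ : Γ_K → ℤ₂ˣ`, principal part dies on the
`ℤ₂²`-tower kernel) and `…QuadraticPartHecke` (B11b: `θ̂` as a framed `θ` with `θ² = 1` and its Hecke
character `θK` by primitive Artin reciprocity, `KellerYin2024.IsHeckeCharOf ι θ θK`, exact ramification).
The v10 frame of S2′/S3b′ binds `θK ρ : HeckeCharacter K`, `r : FramedGaloisRep K ℚ̄₂ 1` with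
`θK * θK = 1 → IsPAdicAvatarOf ι ρ r → FactorsThroughPair κ₁ κ₂ r → θK⁻¹ * ρ = (ψ∘c)⁻¹ → …`; THIS FILE
supplies the `θK`-side of that triple:

* §1 (any `p`, any framed `θ : Γ_K → GL₁(𝓞_{ℚ_p(S)})`) **`hasFrobCharpolyAt_entry_of_isUnramifiedAt`**
  (at a place where `θ` is unramified, EVERY arithmetic Frobenius `Φ` above it gives
  `θ.HasFrobCharpolyAt w (X − θ(Φ)₀₀)` — the tree's `GaloisRep.hasFrobCharpolyAt_frobCharpoly_holds`
  read in rank one) and **`valueAtUniformizer_eq_of_isHeckeCharOf`** (the ARITHMETIC-Frobenius reading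
  of `IsHeckeCharOf`: `θK(ϖ_w) = ι(θ(Φ)₀₀)` for every arithmetic Frobenius `Φ` above an unramified `w`).
* §2 (`p = 2`, the sign) `valueAtUniformizer_eq_one_or_eq_neg_one` (`θK(ϖ_w) = ±1` off the
  ramification), **`mul_self_eq_one_of_sign`** (`θK * θK = 1`: a Hecke character with `χ(ϖ_v) = 1` for
  almost all `v` is trivial, `HeckeCharacter.eq_one_of_eventually_valueAtUniformizer_eq_one`),
  **`exists_avatar_of_sign`** (the `ℚ̄₂`-valued framed sign `r_θ = FramedGaloisRep.ofOpenKer`, entries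
  `θ̂(σ) ∈ {±1}`, `r_θ σ = 1 ↔ θ̂ σ = 1`, IS a `2`-adic avatar of `θK`: `IsPAdicAvatarOf ι θK r_θ` — at an
  unramified `v ∤ 2`, `r_θ` is unramified and `r_θ(Frob^{arith}) = θ̂(Frob) = θ̂(Frob)⁻¹ = ι⁻¹(θK(ϖ_v))⁻¹`),
  and the package **`exists_sign_heckeChar_avatar`** for an imaginary quadratic `K` and any continuous
  `χ : Γ_K →ₜ* ℤ₂ˣ`: `θ̂, θ, θK, r_θ` with all of the above and `χ·θ̂ = 1` on `pairKer κ₁ κ₂` of every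
  generator pair.  Remaining for the v10 triple: O2′ (`χ` := a `ℤ₂ˣ`-valued avatar of `(ψ∘c)⁻¹`) and the
  avatar of the product `θK·(ψ∘c)⁻¹` (rigidity of rank-one avatars; -w5's twist algebra).

HONEST FRAMING: plumbing over the tree's class field theory and Frobenius bookkeeping; closes nothing;
beyond-print theorem: no.  BSD is not proved by any of this.

References: [SerreAbelianLadic1968] Ch. I §2.1, Ch. III §2.3; [CasselsFrohlichANT1967] Ch. VII §4
Prop. 4.1, §5.1; [CastellaHsieh2018] §3.3; [deShalit1987] II.4.17 (54).
-/

-- the summit namespace `Summit.BirchSwinnertonDyer.BirchSwinnertonDyer` repeats the problem name by design (D-0017)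
set_option linter.dupNamespace false
set_option autoImplicit false

noncomputable section

open scoped Classical

open Polynomial NumberField IsDedekindDomain Field Filter
  Literature.NumberTheory.EllipticCurves Literature.NumberTheory.GaloisRepresentations
  Literature.NumberTheory.EllipticCurves.KellerYin2024
open Summit.BirchSwinnertonDyer.BirchSwinnertonDyer.Theorems.EisensteinPrimesMuLambda

namespace Summit.BirchSwinnertonDyer.BirchSwinnertonDyer.Theorems.PrintCf2.QuadraticPart

/-! ## §1 The arithmetic-Frobenius reading of `IsHeckeCharOf` -/

section Frobenius

variable {K : Type} [Field K] [NumberField K] {p : ℕ} [hp : Fact p.Prime] (S : Set (PadicAlgCl p))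
  (ι : PadicAlgCl p ≃+* ℂ)

/-- **At an unramified place every arithmetic Frobenius computes the Frobenius polynomial** of a
rank-one framed `θ : Γ_K → GL₁(𝓞)`: `θ.HasFrobCharpolyAt w (X − θ(Φ)₀₀)` for every arithmetic Frobenius
`Φ` at every prime above `w` (Frobenii at `𝔓` form a coset of inertia, primes above `w` are conjugate:
the tree's `GaloisRep.hasFrobCharpolyAt_frobCharpoly_holds`, read through
`FramedGaloisRep.charpoly_eq_of_rank_one`). [cite: SerreAbelianLadic1968, Ch. I §2.1] -/
theorem hasFrobCharpolyAt_entry_of_isUnramifiedAt (θ : FramedGaloisRep K (padicCoeffIntegers S) 1)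
    {w : HeightOneSpectrum (𝓞 K)} (hw : θ.IsUnramifiedAt w) :
    ∀ 𝔓 ∈ w.primesAbove, ∀ Φ : absoluteGaloisGroup K, IsArithFrobAt (𝓞 K) Φ 𝔓 →
      θ.HasFrobCharpolyAt w (X - C (entry S θ Φ)) := by
  intro 𝔓 h𝔓 Φ hΦ
  have hu : θ.toGaloisRep.IsUnramifiedAt w :=
    (FramedGaloisRep.isUnramifiedAt_toGaloisRep_iff w θ).mpr hw
  have hP : θ.HasFrobCharpolyAt w (θ.toGaloisRep.frobCharpoly w) :=
    (FramedGaloisRep.hasFrobCharpolyAt_toGaloisRep_iff w _ θ).mp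
      (GaloisRep.hasFrobCharpolyAt_frobCharpoly_holds hu)
  have hev : FramedRep.charpoly θ Φ = θ.toGaloisRep.frobCharpoly w := hP 𝔓 h𝔓 Φ hΦ
  rw [FramedGaloisRep.charpoly_eq_of_rank_one] at hev
  rw [← hev] at hP
  exact hP

/-- **`θK(ϖ_w) = ι(θ(Φ)₀₀)` for every arithmetic Frobenius `Φ` above a place where `θ` is
unramified**, whenever `KellerYin2024.IsHeckeCharOf ι θ θK` (the predicate quantifies over `a` with
`HasFrobCharpolyAt w (X − a)`; `hasFrobCharpolyAt_entry_of_isUnramifiedAt` supplies `a = θ(Φ)₀₀`).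
[cite: CastellaGrossiLeeSkinner2022, Thm. 2.1.2 (θ_K)] [cite: SerreAbelianLadic1968, Ch. I §2.1] -/
theorem valueAtUniformizer_eq_of_isHeckeCharOf {θ : FramedGaloisRep K (padicCoeffIntegers S) 1}
    {θK : HeckeCharacter K} (hH : IsHeckeCharOf ι θ θK) {w : HeightOneSpectrum (𝓞 K)}
    (hw : θ.IsUnramifiedAt w) :
    ∀ 𝔓 ∈ w.primesAbove, ∀ Φ : absoluteGaloisGroup K, IsArithFrobAt (𝓞 K) Φ 𝔓 →
      θK.valueAtUniformizer w = ι ((entry S θ Φ : padicCoeffIntegers S) : PadicAlgCl p) :=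
  fun 𝔓 h𝔓 Φ hΦ ↦ (hH w hw).2 _ (hasFrobCharpolyAt_entry_of_isUnramifiedAt S θ hw 𝔓 h𝔓 Φ hΦ)

end Frobenius

/-! ## §2 At `p = 2`: the Hecke character of the sign is quadratic, and the sign is its avatar -/

section Two

variable {K : Type} [Field K] [NumberField K] (S : Set (PadicAlgCl 2)) (ι : PadicAlgCl 2 ≃+* ℂ)

/-- `ι` of the image of `±1 ∈ ℤ₂` in `𝓞 ⊆ ℚ̄₂` is `±1 ∈ ℂ`. [folklore] -/
private theorem iota_coe_padicIntToCoeff_of_eq_one_or {u : ℤ_[2]ˣ} (hu : u = 1 ∨ u = -1) :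
    ι ((padicIntToCoeff S (u : ℤ_[2]) : padicCoeffIntegers S) : PadicAlgCl 2) = 1 ∨
      ι ((padicIntToCoeff S (u : ℤ_[2]) : padicCoeffIntegers S) : PadicAlgCl 2) = -1 := by
  rcases hu with h | h
  · left
    rw [h, Units.val_one, map_one, OneMemClass.coe_one, map_one]
  · right
    rw [h, Units.val_neg, Units.val_one, map_neg, map_one]
    push_cast
    rw [map_neg, map_one]

/-- **`θK(ϖ_w) = ±1` off the ramification**: for the framed sign `θ` (entries `θ̂(σ) ∈ {±1} ⊂ ℤ₂ ⊂ 𝓞`)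
and its Hecke character `θK` (`IsHeckeCharOf ι θ θK`), at every place where `θ` is unramified.
[cite: CastellaGrossiLeeSkinner2022, Thm. 2.1.2 (θ_K)] -/
theorem valueAtUniformizer_eq_one_or_eq_neg_one {θs : absoluteGaloisGroup K →ₜ* ℤ_[2]ˣ}
    (hθs : ∀ σ, θs σ = 1 ∨ θs σ = -1) {θ : FramedGaloisRep K (padicCoeffIntegers S) 1}
    (hentry : ∀ σ, entry S θ σ = padicIntToCoeff S ((θs σ : ℤ_[2]ˣ) : ℤ_[2]))
    {θK : HeckeCharacter K} (hH : IsHeckeCharOf ι θ θK) {w : HeightOneSpectrum (𝓞 K)}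
    (hw : θ.IsUnramifiedAt w) :
    θK.valueAtUniformizer w = 1 ∨ θK.valueAtUniformizer w = -1 := by
  obtain ⟨𝔓, h𝔓⟩ := w.primesAbove_nonempty
  obtain ⟨Φ, hΦ⟩ :=
    IsDedekindDomain.HeightOneSpectrum.exists_isArithFrobAt_of_mem_primesAbove_holds (K := K) (v := w) h𝔓
  rw [valueAtUniformizer_eq_of_isHeckeCharOf S ι hH hw 𝔓 h𝔓 Φ hΦ, hentry Φ]
  exact iota_coe_padicIntToCoeff_of_eq_one_or S ι (hθs Φ)

/-- **The Hecke character of the sign is QUADRATIC: `θK * θK = 1`** (the v10 binder `θK * θK = 1`):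
`(θK²)(ϖ_w) = (±1)² = 1` at the cofinitely many places where `θK` — equivalently `θ` — is unramified
(`HeckeCharacter.isUnramifiedAt_cofinite_holds`), and a Hecke character trivial on almost all
uniformizers is trivial (`HeckeCharacter.eq_one_of_eventually_valueAtUniformizer_eq_one`, Cassels–Fröhlich
VII §4 Prop. 4.1). [cite: CasselsFrohlichANT1967, Ch. VII §4 Prop. 4.1 (proof)] -/
theorem mul_self_eq_one_of_sign {θs : absoluteGaloisGroup K →ₜ* ℤ_[2]ˣ}
    (hθs : ∀ σ, θs σ = 1 ∨ θs σ = -1) {θ : FramedGaloisRep K (padicCoeffIntegers S) 1}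
    (hentry : ∀ σ, entry S θ σ = padicIntToCoeff S ((θs σ : ℤ_[2]ˣ) : ℤ_[2]))
    {θK : HeckeCharacter K} (hH : IsHeckeCharOf ι θ θK)
    (hram : ∀ w : HeightOneSpectrum (𝓞 K), θK.IsUnramifiedAt w ↔ θ.IsUnramifiedAt w) :
    θK * θK = 1 := by
  refine HeckeCharacter.eq_one_of_eventually_valueAtUniformizer_eq_one
    ((HeckeCharacter.isUnramifiedAt_cofinite_holds θK).mono fun w hw ↦ ?_)
  rw [HeckeCharacter.valueAtUniformizer_mul']
  rcases valueAtUniformizer_eq_one_or_eq_neg_one S ι hθs hentry hH ((hram w).mp hw) with h | h <;>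
    rw [h] <;> norm_num

/-- The structure map `ℤ₂ → ℚ₂ → ℚ̄₂` as a ring homomorphism. [folklore] -/
private theorem coe_padicIntToCoeff_eq (x : ℤ_[2]) :
    ((padicIntToCoeff S x : padicCoeffIntegers S) : PadicAlgCl 2) =
      ((algebraMap ℚ_[2] (PadicAlgCl 2)).comp PadicInt.Coe.ringHom) x := rfl

/-- **The `ℚ̄₂`-valued framed sign IS a `2`-adic avatar of `θK`.**  For the sign data (`θ̂` valued
`±1`, framed `θ` with entries `θ̂`, `θ σ = 1 ↔ θ̂ σ = 1`, `θK` with `IsHeckeCharOf ι θ θK` and exact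
ramification) there is `r : Γ_K →ₜ* GL₁(ℚ̄₂)` (`FramedGaloisRep.ofOpenKer` of `ℤ₂ˣ → ℚ̄₂ˣ ∘ θ̂`, open
kernel `{θ̂ = 1}`) with entries `θ̂(σ)`, `r σ = 1 ↔ θ̂ σ = 1`, and **`IsPAdicAvatarOf ι θK r`**: at
`v ∤ 2` with `θK` unramified, `r` is unramified and every arithmetic Frobenius has entry
`θ̂(Frob) = θ̂(Frob)⁻¹ = ι⁻¹(θK(ϖ_v))⁻¹`. [cite: SerreAbelianLadic1968, Ch. III §2.3]
[cite: CastellaHsieh2018, §3.3] -/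
theorem exists_avatar_of_sign {θs : absoluteGaloisGroup K →ₜ* ℤ_[2]ˣ}
    (hθs : ∀ σ, θs σ = 1 ∨ θs σ = -1) {θ : FramedGaloisRep K (padicCoeffIntegers S) 1}
    (hentry : ∀ σ, entry S θ σ = padicIntToCoeff S ((θs σ : ℤ_[2]ˣ) : ℤ_[2]))
    (hθ1 : ∀ σ, θ σ = 1 ↔ θs σ = 1) {θK : HeckeCharacter K} (hH : IsHeckeCharOf ι θ θK)
    (hram : ∀ w : HeightOneSpectrum (𝓞 K), θK.IsUnramifiedAt w ↔ θ.IsUnramifiedAt w) :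
    ∃ r : FramedGaloisRep K (PadicAlgCl 2) 1,
      (∀ σ (i j : Fin 1), ((r σ : GL (Fin 1) (PadicAlgCl 2)) : Matrix (Fin 1) (Fin 1) (PadicAlgCl 2)) i j =
        ((algebraMap ℚ_[2] (PadicAlgCl 2)).comp PadicInt.Coe.ringHom) ((θs σ : ℤ_[2]ˣ) : ℤ_[2])) ∧
      (∀ σ, r σ = 1 ↔ θs σ = 1) ∧ IsPAdicAvatarOf ι θK r := by
  set jr : ℤ_[2] →+* PadicAlgCl 2 := (algebraMap ℚ_[2] (PadicAlgCl 2)).comp PadicInt.Coe.ringHom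
    with hjr
  let θ' : absoluteGaloisGroup K →* (PadicAlgCl 2)ˣ :=
    (Units.map (jr : ℤ_[2] →* PadicAlgCl 2)).comp θs.toMonoidHom
  have hθ' : ∀ σ, ((θ' σ : (PadicAlgCl 2)ˣ) : PadicAlgCl 2) = jr ((θs σ : ℤ_[2]ˣ) : ℤ_[2]) :=
    fun σ ↦ rfl
  have hsq : ∀ σ, jr ((θs σ : ℤ_[2]ˣ) : ℤ_[2]) * jr ((θs σ : ℤ_[2]ˣ) : ℤ_[2]) = 1 := fun σ ↦ by
    rw [← map_mul, ← Units.val_mul]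
    rcases hθs σ with h | h <;> rw [h] <;> simp
  -- `θ' σ = 1 ↔ θs σ = 1`
  have hone : ∀ σ, θ' σ = 1 ↔ θs σ = 1 := fun σ ↦ by
    constructor
    · intro h
      rcases hθs σ with h1 | h1
      · exact h1
      · exfalso
        have h2 := congrArg (fun u : (PadicAlgCl 2)ˣ ↦ (u : PadicAlgCl 2)) h
        simp only [hθ', h1, Units.val_neg, Units.val_one, map_neg, map_one] at h2
        norm_num at h2
    · intro h
      apply Units.ext
      rw [hθ', h, Units.val_one, map_one, Units.val_one]
  -- the kernel `{θs = 1} = θs⁻¹ {-1}ᶜ` is open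
  have hopen : IsOpen (θ'.ker : Set (absoluteGaloisGroup K)) := by
    have heq : (θ'.ker : Set (absoluteGaloisGroup K)) = θs ⁻¹' ({-1}ᶜ) := by
      ext σ
      rw [SetLike.mem_coe, MonoidHom.mem_ker, hone, Set.mem_preimage, Set.mem_compl_iff,
        Set.mem_singleton_iff]
      constructor
      · intro h h'
        rw [h] at h'
        have h2 := congrArg (fun u : ℤ_[2]ˣ ↦ PadicInt.toZModPow 2 (u : ℤ_[2])) h'
        simp only [Units.val_one, Units.val_neg, map_one, map_neg] at h2
        exact absurd h2 (by decide)
      · intro h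
        rcases hθs σ with h1 | h1
        · exact h1
        · exact absurd h1 h
    rw [heq]
    exact isClosed_singleton.isOpen_compl.preimage θs.continuous
  refine ⟨FramedGaloisRep.ofOpenKer θ' hopen, fun σ i j ↦ ?_, fun σ ↦ ?_, fun v hv hKv ↦ ?_⟩
  · rw [FramedGaloisRep.ofOpenKer_apply_coe, hθ']
  · exact (FramedGaloisRep.ofOpenKer_apply_eq_one_iff θ' hopen σ).trans (hone σ)
  · have hθv : θ.IsUnramifiedAt v := (hram v).mp hKv
    refine ⟨(FramedGaloisRep.isUnramifiedAt_ofOpenKer_iff θ' hopen v).mpr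
      fun 𝔓 h𝔓 σ hσ ↦ (hone σ).mpr ((hθ1 σ).mp (hθv 𝔓 h𝔓 σ hσ)), ?_⟩
    refine (FramedGaloisRep.hasFrobCharpolyAt_ofOpenKer_iff θ' hopen v _).mpr fun 𝔓 h𝔓 Φ hΦ ↦ ?_
    have hval := valueAtUniformizer_eq_of_isHeckeCharOf S ι hH hθv 𝔓 h𝔓 Φ hΦ
    rw [hentry Φ, coe_padicIntToCoeff_eq] at hval
    rw [hθ', hval, RingEquiv.symm_apply_apply]
    exact (inv_eq_of_mul_eq_one_right (hsq Φ)).symm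

/-- **The sign of a `ℤ₂ˣ`-valued character of an imaginary quadratic field: its Hecke character is
quadratic and it is its own `2`-adic avatar (package).**  For `K` imaginary quadratic, `ι : ℚ̄₂ ≃ ℂ`,
`S`, and a continuous `χ : Γ_K →ₜ* ℤ₂ˣ`: there are the sign `θ̂` (values `±1`, `χθ̂ ≡ 1 (mod 4)`), the
framed `θ : Γ_K →ₜ* GL₁(𝓞_{ℚ₂(S)})` (`θ² = 1`, `θ σ = 1 ↔ θ̂ σ = 1`), a Hecke character `θK` of finite
order with `KellerYin2024.IsHeckeCharOf ι θ θK`, exact ramification and **`θK * θK = 1`**, and a framed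
`r : Γ_K →ₜ* GL₁(ℚ̄₂)` with entries `θ̂`, `r σ = 1 ↔ θ̂ σ = 1` and **`IsPAdicAvatarOf ι θK r`**; and
`χ(σ)·θ̂(σ) = 1` on `pairKer κ₁ κ₂` for EVERY generator pair of the `ℤ₂²`-tower (B11).
[cite: NeukirchANT1999, Ch. VII §10 Thm. (10.6)] [cite: SerreAbelianLadic1968, Ch. III §2.3]
[cite: deShalit1987, II.4.17 (54)] -/
theorem exists_sign_heckeChar_avatar (hK : IsImaginaryQuadratic K)
    (χ : absoluteGaloisGroup K →ₜ* ℤ_[2]ˣ) :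
    ∃ (θs : absoluteGaloisGroup K →ₜ* ℤ_[2]ˣ) (θ : FramedGaloisRep K (padicCoeffIntegers S) 1)
      (θK : HeckeCharacter K) (r : FramedGaloisRep K (PadicAlgCl 2) 1),
      (∀ σ, θs σ = 1 ∨ θs σ = -1) ∧ (∀ σ, (4 : ℤ_[2]) ∣ (χ σ : ℤ_[2]) * (θs σ : ℤ_[2]) - 1) ∧
      (∀ σ, θ σ ^ 2 = 1) ∧ (∀ σ, θ σ = 1 ↔ θs σ = 1) ∧
      θK.IsFiniteOrder ∧ IsHeckeCharOf ι θ θK ∧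
      (∀ w : HeightOneSpectrum (𝓞 K), θK.IsUnramifiedAt w ↔ θ.IsUnramifiedAt w) ∧ θK * θK = 1 ∧
      (∀ σ (i j : Fin 1), ((r σ : GL (Fin 1) (PadicAlgCl 2)) : Matrix (Fin 1) (Fin 1) (PadicAlgCl 2)) i j =
        ((algebraMap ℚ_[2] (PadicAlgCl 2)).comp PadicInt.Coe.ringHom) ((θs σ : ℤ_[2]ˣ) : ℤ_[2])) ∧
      (∀ σ, r σ = 1 ↔ θs σ = 1) ∧ IsPAdicAvatarOf ι θK r ∧
      ∀ {κ₁ κ₂ : ZpExtension K 2} {γ₁ γ₂ : absoluteGaloisGroup K},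
        ZpExtension.IsTopGeneratorPair κ₁ κ₂ γ₁ γ₂ →
        ∀ {σ : absoluteGaloisGroup K}, σ ∈ ZpExtension.pairKer κ₁ κ₂ → χ σ * θs σ = 1 := by
  obtain ⟨θs, θ, θK, hθs, hθsχ, hθ2, hθ1, hentry, hfin, hH, hram, hker⟩ :=
    exists_signChar_framed_heckeChar S ι hK χ
  obtain ⟨r, hr, hr1, hav⟩ := exists_avatar_of_sign S ι hθs hentry hθ1 hH hram
  exact ⟨θs, θ, θK, r, hθs, hθsχ, hθ2, hθ1, hfin, hH, hram, mul_self_eq_one_of_sign S ι hθs hentry hH hram,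
    hr, hr1, hav, fun hpair _ hσ ↦ hker hpair hσ⟩

end Two

end Summit.BirchSwinnertonDyer.BirchSwinnertonDyer.Theorems.PrintCf2.QuadraticPart

end
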